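import Summits.QuantumFields.YangMills.Theorems.BalabanUVNodesN20InvarianceAtGap2ReadingCmap
import Summits.QuantumFields.YangMills.Theorems.BalabanUVNodesN20K3AxV8Stub2LedgerCutZero

/-!
# K3ᴬ v8 STUB 2 AT A GENERAL (BELOW-TOP) CUT READING — THE THREE-SUPPLIER LEDGER BY NAME: N20 = `RelWeightBound` witnesses at the RE-CENTRED RECORD's OWN carriers with the
# cut's bad class (dial-free), N19′ = `NE7.Core` with the cut's bad class on the doubly-gapped cores (live line), node U5 = `Target` off the line; the pin, N21 and N27x PAID

Cell `pub-ymgap` (HUMAN RULING D-0062, Track A), seat `pub-ymgap-dag-n20-d` (gen 47; R134 (a) N20 s3; op-5c-class K3ᴬ supply, `--kind proof --supports stmt-QuantumFields-27247 --as helper`;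
count-neutral; proves NO registered stub).  Companion of the ZERO-cut ledger of record ✓p816278 `…N20K3AxV8Stub2LedgerCutZero.stub2Text_of_dialRows_emptyBadCore_cutZero` (where N20
is free and N19′ owes NE7 proper on ALL keyed classes): here the prover's cut reading `jc` is ANY policy cutting strictly below the top or not at all (`jc … K < K ∨ jc … K = 0`, the
persistence policies of [LF-II] (1.80)), N20's conjunct is the PRICED row — a `RelWeightBound` witness at the re-centred record's OWN carriers `weightA∕B₁₃Ax θ 0 g₀ os hP` with the
cut's bad class `badClass₁₃Ax θ 0 g₀ (jc …)`, DIAL-FREE by `…N20InvarianceAtGap2ReadingCmap` §4 — and N19′'s core is asked only OFF that bad class.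
[LF-I] = [Balaban1989LargeFieldI], [LF-II] = [Balaban1989LargeFieldII].
CONTENTS.  §1 AT THE MIRROR (`N = 2`): ★★ `exists_gap2PinnedSplitReading_allFaces_of_witnesses` — from a below-top cut reading `jc`, dials with `DialRows ρ ρ′ n₁ n₂`, N20's witness
row (live line), N19′'s `NE7.Core` witness with bad class `badClass₁₃Ax θ 0 g₀ (jc …)` on the re-centred doubly-gapped cores (live line, slot-keyed: under (B) → END →
`ForSmallCouplings (datumOfRecord₁₃SepCoPHVAx …)` → `PHolderD4 β`) and node U5's `Target` at the datum OFF the line: ∃ cr, `PinnedAtLiveGap2 jc ρ ρ′ n₁ n₂ cr` ∧ the off-live pin ∧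
`KeyedRelWeight cr ∧ KeyedShellWeight cr ∧ KeyedExtractionV cr ∧ KeyedCoreEdgeHolderD4V β cr rr` (✓p813406 §5 ∕ ✓p813854 §4 ∕ ✓p816278 §1 ∕ `…N20InvarianceAtGap2ReadingCmap` §4).
§2 ★★★ THE BILL `stub2Text_of_dialRows_recordRelWeight_core_target`: per `β ∈ ]2∕3, 1[` and guarded K4-faced reading `(𝔯, ksel, …)`, the five displayed rows ⟹ THE REGISTERED STUB-2
TEXT (`K3Skeleton13SepCoPHAxV8.stub_expansion13HV`'s type, byte for byte).
▶ THE LEDGER AT A GENERAL CUT (located, count-neutral): K3ᴬ v8's stub 2 ⟸ [prover] a below-top cut reading `jc` and dials `ρ ρ′ n₁ n₂` with `DialRows` ∧ [N20, live line, per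
guarded admissible tuple] `∃ W, RelWeightBound 1 (classSet₁₃Ax θ 0 g₀) (weightA₁₃Ax θ 0 g₀ os hP) (weightB₁₃Ax θ 0 g₀ os hP) (badClass₁₃Ax θ 0 g₀ (jc …)) W` (NE7b — NOT PRINTED for
`d = 4`; the conclusion shape of this lineage's road-[e] priced face ✓p791592, CoPH-keyed, whose χ ∕ Ax re-keying is NOT in this file) ∧ [N19′, live line, slot-keyed prefix]
`∃ δ, NE7.Core 1 (F.side⁴) (classSet₁₃Ax θ 0 g₀) (badClass₁₃Ax θ 0 g₀ (jc …)) (gapCore2A₁₃Chi θ (chiβOfRecord₁₃Ax …) h.toCore 0 g₀ os ρ… ρ′… n₁… n₂…) (gapCore2B₁₃Chi …) δ ∧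
Summable δ` (NE7 proper OFF the cut's bad class — NOT PRINTED for `d = 4`) ∧ [node U5, off the line] `∃ δ, NE7.Target (F.side⁴) 1 δ (K ↦ Z_K)` at `datumOfRecord₁₃CoPHAx` (NOT PRINTED).
The pin, N21 (`KeyedShellWeight`), N27x (`KeyedExtractionV`) are PAID BY NAME at any cut (✓p813854 `keyedShell_extraction_of_liveGap2Pin`).
HONEST FRAMING.  [folklore] case-split ∕ `rfl` bookkeeping BY NAME; NO estimate of Bałaban's; the three displayed rows are the content of nodes N20 ∕ N19′ ∕ U5, NOT PRINTED for
`d = 4`, HYPOTHESES asserted for no family; NO stub of K3ᴬ v8 is closed or claimed (0∕2); no `Provisos₁₃CoPHChi ∕ …Ax` inhabitant claimed (K0ᴬ OPEN); N19 ∕ N20 ∕ N21 ∕ N27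
NOT discharged; counts UNMOVED (typed 28∕28 · discharged 8∕27 · A 8∕28 · K 1∕4); never a count claim.  One finite `𝕋⁴_{L^K}` programme at fixed `ε = L^{−K}`, Bałaban AS PRINTED —
NOT ℝ⁴, NOT infinite volume, NOT OS, NOT a mass gap; the YM mass gap (Clay) is NOT proved by any of this.  No `def`, no `instance`, no `notation`, no `sorry`, standard axioms.
Sources (locators, bookkeeping only): [LF-II] Thm 1 + (0.1) pp.355–356, (1.79) p.383, (1.80) p.384, (1.89) p.387; [LF-I] (0.2)–(0.4) p.176, p.181; [King1986] (3.10)–(3.11) p.656.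
-/

set_option autoImplicit false

noncomputable section

open scoped BigOperators
open Finset MeasureTheory

namespace Summit.QuantumFields.YangMills.BalabanUVNodes.N20K3AxV8Stub2LedgerAnyCut

open Literature.MathematicalPhysics.QuantumFieldTheory.Balaban1983to89
open Literature.MathematicalPhysics.QuantumFieldTheory.Balaban1983to89.T4Continuum
open Literature.MathematicalPhysics.QuantumFieldTheory.Balaban1983to89.Node00
open Literature.MathematicalPhysics.QuantumFieldTheory.Balaban1983to89.T4ContinuumYM4Torus (ForSmallCouplings)
open Summit.QuantumFields.BalabanUV.T4Continuum.Spine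
open T4WeightBudget (RelWeightBound)
open YMDAG.UVSplit (classSet₁₃Chi badClass₁₃Chi classSet₁₃Ax weightA₁₃Ax weightB₁₃Ax badClass₁₃Ax)
open Summit.QuantumFields.YangMills.Theorems.N21ShellSplitOfRecord13CoPH (WidthLetter₁₃CoPHAx DepthLetter₁₃CoPHAx)
open Summit.QuantumFields.YangMills.Theorems.N21GappedTopPair13CoPH (gapCore2A₁₃Chi gapCore2B₁₃Chi crGap2₁₃VAtCmap crGap2₁₃VAx keyedShell_extraction_of_liveGap2Pin)
open Summit.QuantumFields.YangMills.Theorems.K3AxV8Defs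
open Summit.QuantumFields.YangMills.BalabanUVNodes.N20OffLiveOneTermReadingCmap (crOneTerm₁₃Ax exists_reading_livePin keyedCoreEdgeHolderD4V_of_livePin)
open Summit.QuantumFields.YangMills.BalabanUVNodes.N20InvarianceAtGap2ReadingCmap (keyedRelWeight_of_liveGap2Pin_of_recordWitness)
open Summit.QuantumFields.YangMills.BalabanUVNodes.N20K3AxV8Stub2LedgerCutZero (core_crGap2₁₃VAtCmap_of_witness)

/-! ## §1 At the K3ᴬ v8 mirror (`N = 2`): the gap-pinned split reading at a below-top cut reading carries v8's pin and ALL FOUR face conjuncts -/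

section Mirror

variable (β : ℝ) (rr : RateReadingFn) (jc : CutReading) (ρ ρ' : WidthLetter₁₃CoPHAx 2) (n₁ n₂ : DepthLetter₁₃CoPHAx 2)

/-- ★★ **THE GAP-PINNED SPLIT READING AT A BELOW-TOP CUT READING CARRIES v8's PIN AND ALL FOUR FACE CONJUNCTS** — from a cut reading `jc` cutting strictly below the top or not at
all, the dial rows `DialRows ρ ρ′ n₁ n₂`, node N20's `RelWeightBound` witness at the RE-CENTRED RECORD's OWN carriers with the cut's bad class on every guarded admissible tuple of the
LIVE LINE (NE7b — NOT PRINTED for `d = 4`), node N19′'s `NE7.Core` witness OFF THE CUT's BAD CLASS on the re-centred doubly-gapped cores there (slot-keyed: under (B) → END →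
`ForSmallCouplings (datumOfRecord₁₃SepCoPHVAx …)` → `PHolderD4 β`; NE7 — NOT PRINTED for `d = 4`) and node U5's `Target` at the datum OFF the line (NOT PRINTED): ∃ cr,
`PinnedAtLiveGap2 jc ρ ρ′ n₁ n₂ cr` ∧ off-live pin ∧ `KeyedRelWeight cr ∧ KeyedShellWeight cr ∧ KeyedExtractionV cr ∧ KeyedCoreEdgeHolderD4V β cr rr`.  All three displayed rows are the
nodes' content, asserted for no family. [cite: Balaban1989LargeFieldII, Thm 1 + (0.1) pp.355–356, (1.79) p.383, (1.80) p.384, (1.89) p.387; King1986, (3.10)–(3.11) p.656 (bookkeeping)] -/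
theorem exists_gap2PinnedSplitReading_allFaces_of_witnesses
    (hjc : ∀ (F : T4Family) (θ : Stage13HParams F 2) (hP : θ.Provisos₁₃CoPHAx F 2) (g₀ : ℕ → ℝ) (os : List (ULoop F)) (K : ℕ),
      jc F θ hP g₀ os K < K ∨ jc F θ hP g₀ os K = 0)
    (hd : DialRows ρ ρ' n₁ n₂)
    (hW : ∀ (F : T4Family) (θ : Stage13HParams F 2) (hP : θ.Provisos₁₃CoPHAx F 2), ((θ.ZhUnity F 2 ∧ θ.SlotsNondegenerate₁₃Ax F 2) ∧ LiveSel F θ) → θ.Admissible F 2 →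
      ∀ (g₀ : ℕ → ℝ) (os : List (ULoop F)), ∃ W : ℕ → ℝ,
        RelWeightBound 1 (classSet₁₃Ax θ 0 g₀) (weightA₁₃Ax θ 0 g₀ os hP) (weightB₁₃Ax θ 0 g₀ os hP) (badClass₁₃Ax θ 0 g₀ (jc F θ hP g₀ os)) W)
    (hcore : ∀ (F : T4Family) (θ : Stage13HParams F 2) (h : θ.Provisos₁₃SepCoPHAx F 2) (v : Revision₁₃Ax F 2 θ h),
      ((θ.ZhUnity F 2 ∧ θ.SlotsNondegenerate₁₃Ax F 2) ∧ LiveSel F θ) → θ.Admissible F 2 →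
      B16.EndStatementBPrinted (datumOfRecord₁₃SepCoPHVAx F 2 θ h v).C → DagBinding.EndpointExistence (datumOfRecord₁₃SepCoPHVAx F 2 θ h v).C.toB12 →
        ForSmallCouplings (datumOfRecord₁₃SepCoPHVAx F 2 θ h v) fun g₀ => ∀ os : List (ULoop F),
          PHolderD4 β (datumOfRecord₁₃SepCoPHVAx F 2 θ h v) (rr F θ h.toCore g₀ os) →
            letI : DecidableEq (Σ K, SiteSeqKey F (0 + K)) := Classical.decEq _
            ∃ δ : ℕ → ℝ, NE7.Core 1 ((F.side : ℝ) ^ 4) (classSet₁₃Ax θ 0 g₀) (badClass₁₃Ax θ 0 g₀ (jc F θ h.toCore g₀ os))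
              (gapCore2A₁₃Chi θ (chiβOfRecord₁₃Ax F 2 θ.toStage13Params) h.toCore 0 g₀ os (ρ F θ h.toCore g₀ os) (ρ' F θ h.toCore g₀ os) (n₁ F θ h.toCore g₀ os)
                (n₂ F θ h.toCore g₀ os))
              (gapCore2B₁₃Chi θ (chiβOfRecord₁₃Ax F 2 θ.toStage13Params) h.toCore 0 g₀ os (ρ F θ h.toCore g₀ os) (ρ' F θ h.toCore g₀ os) (n₁ F θ h.toCore g₀ os)
                (n₂ F θ h.toCore g₀ os)) δ ∧ Summable δ)
    (htarget : ∀ (F : T4Family) (θ : Stage13HParams F 2) (hP : θ.Provisos₁₃CoPHAx F 2), ((θ.ZhUnity F 2 ∧ θ.SlotsNondegenerate₁₃Ax F 2) ∧ ¬ LiveSel F θ) →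
      θ.Admissible F 2 → ∀ (g₀ : ℕ → ℝ) (os : List (ULoop F)), PHolderD4 β (datumOfRecord₁₃CoPHAx F 2 θ hP) (rr F θ hP g₀ os) →
        ∃ δ : ℕ → ℝ, NE7.Target ((F.side : ℝ) ^ 4) 1 δ (fun K => T4GenFunBounds.schemeZ ((datumOfRecord₁₃CoPHAx F 2 θ hP).scheme g₀) os (0 + K))) :
    ∃ cr : SpineReading, PinnedAtLiveGap2 jc ρ ρ' n₁ n₂ cr ∧
      (∀ (F : T4Family) (θ : Stage13HParams F 2) (hP : θ.Provisos₁₃CoPHAx F 2) (g₀ : ℕ → ℝ) (os : List (ULoop F)),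
        ¬ LiveSel F θ → cr F θ hP g₀ os = crOneTerm₁₃Ax 0 F θ hP g₀ os) ∧
      KeyedRelWeight cr ∧ KeyedShellWeight cr ∧ KeyedExtractionV cr ∧ KeyedCoreEdgeHolderD4V β cr rr := by
  obtain ⟨cr, hon, hoff⟩ := exists_reading_livePin (fun F θ hP g₀ os => crGap2₁₃VAx (N := 2) (jc F θ hP g₀ os) ρ ρ' n₁ n₂ F θ hP g₀ os)
  obtain ⟨h21, hx⟩ := keyedShell_extraction_of_liveGap2Pin jc ρ ρ' n₁ n₂ hon hoff hd
  refine ⟨cr, hon, hoff, keyedRelWeight_of_liveGap2Pin_of_recordWitness jc ρ ρ' n₁ n₂ hoff hon hjc hW, h21, hx, ?_⟩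
  refine keyedCoreEdgeHolderD4V_of_livePin hon hoff β rr (fun F θ h v hG hθ hB hE => ?_) htarget
  refine ForSmallCouplings.mono (fun g₀ h' os hPr => ?_) (hcore F θ h v hG hθ hB hE)
  obtain ⟨δ, hδ, hsum⟩ := h' os hPr
  exact ⟨δ, core_crGap2₁₃VAtCmap_of_witness (fun F => chiβOfRecord₁₃Ax F 2) 0 (jc F θ h.toCore g₀ os) ρ ρ' n₁ n₂ θ h.toCore g₀ os hδ, hsum⟩

end Mirror

/-! ## §2 The final bill at a general cut reading -/

/-- **★★★ K3ᴬ v8's STUB 2 AT A GENERAL (BELOW-TOP) CUT READING — THE THREE-SUPPLIER LEDGER OF RECORD**: per `β ∈ ]2∕3, 1[` and guarded K4-faced reading `(𝔯, ksel, …)`, a cut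
reading `jc` cutting strictly below the top or not at all, dials `ρ ρ′ n₁ n₂` with `DialRows ρ ρ′ n₁ n₂`, and — on the guarded admissible tuples of the LIVE LINE — node N20's
`RelWeightBound` witness at the re-centred record's OWN carriers `weightA∕B₁₃Ax θ 0 g₀ os hP` with the cut's bad class `badClass₁₃Ax θ 0 g₀ (jc …)` (NE7b; NOT PRINTED for `d = 4`)
and node N19′'s `NE7.Core` witness OFF that bad class on the re-centred doubly-gapped cores (slot-keyed prefix, `PHolderD4 β` at `rrOfRecord 𝔯 ksel`; NE7; NOT PRINTED for
`d = 4`), and node U5's `Target` off the line (NOT PRINTED) ⟹ THE REGISTERED STUB-2 TEXT, byte for byte.  The pin, N21, N27x are PAID BY NAME; the three displayed rows are the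
nodes' content, asserted for no family; NO stub is proved here.  At `jc ≡ 0` the N20 row is free (✓p811026 `relWeightBound_crOfRecord₁₃VAtCmap_cutZero`) and the bill is
✓p816278's. [cite: Balaban1989LargeFieldII, Thm 1 + (0.1) pp.355–356, (1.79) p.383, (1.80) p.384, (1.89) p.387; King1986, (3.10)–(3.11) p.656 (bookkeeping)] -/
theorem stub2Text_of_dialRows_recordRelWeight_core_target
    (h : ∀ β : ℝ, 2 / 3 < β → β < 1 →
      ∀ (𝔯 : RateReading13AxP) (ksel : RunSel) (ℓ : LetterReading) (ℓ₃ : T4Family → Node00.NE3Letters₁₁) (g B : T4Family → ℝ),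
        GuardedReadingN16 𝔯 ksel ℓ ℓ₃ g B → KeyedRatesHolderD4V β (rrOfRecord 𝔯 ksel) →
        ∃ (jc : CutReading) (ρ ρ' : WidthLetter₁₃CoPHAx 2) (n₁ n₂ : DepthLetter₁₃CoPHAx 2),
          (∀ (F : T4Family) (θ : Stage13HParams F 2) (hP : θ.Provisos₁₃CoPHAx F 2) (g₀ : ℕ → ℝ) (os : List (ULoop F)) (K : ℕ),
            jc F θ hP g₀ os K < K ∨ jc F θ hP g₀ os K = 0) ∧
          DialRows ρ ρ' n₁ n₂ ∧
          (∀ (F : T4Family) (θ : Stage13HParams F 2) (hP : θ.Provisos₁₃CoPHAx F 2), ((θ.ZhUnity F 2 ∧ θ.SlotsNondegenerate₁₃Ax F 2) ∧ LiveSel F θ) → θ.Admissible F 2 →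
            ∀ (g₀ : ℕ → ℝ) (os : List (ULoop F)), ∃ W : ℕ → ℝ,
              RelWeightBound 1 (classSet₁₃Ax θ 0 g₀) (weightA₁₃Ax θ 0 g₀ os hP) (weightB₁₃Ax θ 0 g₀ os hP) (badClass₁₃Ax θ 0 g₀ (jc F θ hP g₀ os)) W) ∧
          (∀ (F : T4Family) (θ : Stage13HParams F 2) (h : θ.Provisos₁₃SepCoPHAx F 2) (v : Revision₁₃Ax F 2 θ h),
            ((θ.ZhUnity F 2 ∧ θ.SlotsNondegenerate₁₃Ax F 2) ∧ LiveSel F θ) → θ.Admissible F 2 →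
            B16.EndStatementBPrinted (datumOfRecord₁₃SepCoPHVAx F 2 θ h v).C → DagBinding.EndpointExistence (datumOfRecord₁₃SepCoPHVAx F 2 θ h v).C.toB12 →
              ForSmallCouplings (datumOfRecord₁₃SepCoPHVAx F 2 θ h v) fun g₀ => ∀ os : List (ULoop F),
                PHolderD4 β (datumOfRecord₁₃SepCoPHVAx F 2 θ h v) (rrOfRecord 𝔯 ksel F θ h.toCore g₀ os) →
                  letI : DecidableEq (Σ K, SiteSeqKey F (0 + K)) := Classical.decEq _
                  ∃ δ : ℕ → ℝ, NE7.Core 1 ((F.side : ℝ) ^ 4) (classSet₁₃Ax θ 0 g₀) (badClass₁₃Ax θ 0 g₀ (jc F θ h.toCore g₀ os))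
                    (gapCore2A₁₃Chi θ (chiβOfRecord₁₃Ax F 2 θ.toStage13Params) h.toCore 0 g₀ os (ρ F θ h.toCore g₀ os) (ρ' F θ h.toCore g₀ os) (n₁ F θ h.toCore g₀ os)
                      (n₂ F θ h.toCore g₀ os))
                    (gapCore2B₁₃Chi θ (chiβOfRecord₁₃Ax F 2 θ.toStage13Params) h.toCore 0 g₀ os (ρ F θ h.toCore g₀ os) (ρ' F θ h.toCore g₀ os) (n₁ F θ h.toCore g₀ os)
                      (n₂ F θ h.toCore g₀ os)) δ ∧ Summable δ) ∧
          (∀ (F : T4Family) (θ : Stage13HParams F 2) (hP : θ.Provisos₁₃CoPHAx F 2), ((θ.ZhUnity F 2 ∧ θ.SlotsNondegenerate₁₃Ax F 2) ∧ ¬ LiveSel F θ) →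
            θ.Admissible F 2 → ∀ (g₀ : ℕ → ℝ) (os : List (ULoop F)), PHolderD4 β (datumOfRecord₁₃CoPHAx F 2 θ hP) (rrOfRecord 𝔯 ksel F θ hP g₀ os) →
              ∃ δ : ℕ → ℝ, NE7.Target ((F.side : ℝ) ^ 4) 1 δ (fun K => T4GenFunBounds.schemeZ ((datumOfRecord₁₃CoPHAx F 2 θ hP).scheme g₀) os (0 + K)))) :
    ∀ β : ℝ, 2 / 3 < β → β < 1 →
      ∀ (𝔯 : RateReading13AxP) (ksel : RunSel) (ℓ : LetterReading) (ℓ₃ : T4Family → Node00.NE3Letters₁₁) (g B : T4Family → ℝ),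
        GuardedReadingN16 𝔯 ksel ℓ ℓ₃ g B → KeyedRatesHolderD4V β (rrOfRecord 𝔯 ksel) →
        ∃ (jc : CutReading) (ρ ρ' : WidthLetter₁₃CoPHAx 2) (n₁ n₂ : DepthLetter₁₃CoPHAx 2) (cr : SpineReading), PinnedAtLiveGap2 jc ρ ρ' n₁ n₂ cr ∧ DialRows ρ ρ' n₁ n₂ ∧
          KeyedRelWeight cr ∧ KeyedShellWeight cr ∧ KeyedExtractionV cr ∧ KeyedCoreEdgeHolderD4V β cr (rrOfRecord 𝔯 ksel) := by
  intro β hβ hβ' 𝔯 ksel ℓ ℓ₃ g B hg hr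
  obtain ⟨jc, ρ, ρ', n₁, n₂, hjc, hd, hW, hcore, htarget⟩ := h β hβ hβ' 𝔯 ksel ℓ ℓ₃ g B hg hr
  obtain ⟨cr, hon, -, h20, h21, hx, h19⟩ :=
    exists_gap2PinnedSplitReading_allFaces_of_witnesses β (rrOfRecord 𝔯 ksel) jc ρ ρ' n₁ n₂ hjc hd hW hcore htarget
  exact ⟨jc, ρ, ρ', n₁, n₂, cr, hon, hd, h20, h21, hx, h19⟩

end Summit.QuantumFields.YangMills.BalabanUVNodes.N20K3AxV8Stub2LedgerAnyCut

end
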